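import Summits.AtomisticToContinuum.Crystallization.Theses.IsometryAtoms
import Summits.AtomisticToContinuum.Crystallization.Theorems.MinimisingLawsCohesive.Negative.RootedComb

/-!
# Negative knowledge for crux `MinimisingLawsCohesive` (stmt-AtomisticToContinuum-15777), IV:
# the doubled dimer — the hard-core clause is load-bearing

Standing crux disprover `cdisprove-stmt-AtomisticToContinuum-15777` (cycle 1,
`--supports stmt-AtomisticToContinuum-15777`; parts I–III: `OnePointMixtures.lean`,
`RootedComb.lean`, `ExactFace.lean`).

`minimisingLawsCohesive_false_without_hardCore`: with the clause `∀ᵐ μ ∂P, IsRootedHardCore δ μ` DELETED the crux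
`IsometryAtoms.MinimisingLawsCohesive` is FALSE.  Witness — the DOUBLED DIMER: multiplicity
`m = 2³³` on the root and on one neighbour at distance `1`, rooted uniformly,
`P = ½ δ_{m(δ_0 + δ_v)} + ½ δ_{m(δ_0 + δ_{-v})}`, `‖v‖ = 1`.  Re-rooting swaps the two samples, so
`P` satisfies the Mecke / mass-transport identity verbatim; it is a probability law; its mean root
energy is `m · V_LJ(1)/2 = −2³²/12 ≤ e*` (against the tree's only lower bound on `e*`,
`NearFieldConvexity.Negative.LoadBearing.neg_le_eStar`) because the `m` coincident particles at the
root do not repel (`V_LJ(0) = 0` by `0⁻¹ = 0`); and its support `{0, ±v}` is bounded.  So the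
hard-core clause is what neutralises MULTIPLICITY and the `V(0)` junk at once — its separation
content proper (`0 < δ`) is not what this witness violates (the support is `1`-separated), and any
proof must use that configurations are simple counting measures.  Plumbing: two-atom measures with
a weight (`count_restrict_pair`, `lintegral_smul_dirac_add_dirac`, `map_sub_smul_dirac_add_dirac`,
`rootEnergy_smul_measure`, `rootEnergy_dirac_add_dirac`) and the Giry-measurability of the atom
`{c • count|S}` (`measurableSet_singleton_smul_count_restrict`, the weighted form of
`DiracLaws.measurableSet_singleton_count_restrict`).  All `[folklore]`.
-/

noncomputable section

namespace Summit.AtomisticToContinuum.Crystallization.Theorems.MinimisingLawsCohesive.Negative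

open MeasureTheory Set Filter
open scoped ENNReal Topology
open Literature.MathematicalPhysics.StatisticalMechanics Literature.Probability.Process
open Summit.AtomisticToContinuum.Crystallization.Theorems.ChargedEnergyGapNegative (eStar)
open Summit.AtomisticToContinuum.Crystallization.Theorems.LayeredLawsSelectHcp.Negative.DiracLaws
  (measure_eq_of_compl_null count_restrict_compl count_restrict_singleton ae_dirac_of_mem
    lintegral_dirac_of_mem integral_dirac_of_mem)
open Summit.AtomisticToContinuum.Crystallization.Theorems.NearFieldConvexity.Negative.LoadBearing
  (neg_le_eStar)

/-! ## §1 Two-atom measures with a weight -/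

/-- `count|{a, b} = δ_a + δ_b` for `a ≠ b`. [folklore] -/
theorem count_restrict_pair {a b : (EuclideanSpace ℝ (Fin 3))} (h : a ≠ b) :
    (Measure.count : Measure (EuclideanSpace ℝ (Fin 3))).restrict {a, b} = Measure.dirac a +
        Measure.dirac b := by
  classical
  rw [← Finset.coe_pair, count_restrict_coe_finset, Finset.sum_pair h]

/-- `∫⁻` against `c • (δ_a + δ_b)`. [folklore] -/
theorem lintegral_smul_dirac_add_dirac (c : ℝ≥0∞) (a b : (EuclideanSpace ℝ (Fin 3))) (F :
    (EuclideanSpace ℝ (Fin 3)) → ℝ≥0∞) :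
    ∫⁻ y, F y ∂(c • (Measure.dirac a + Measure.dirac b)) = c * (F a + F b) := by
  rw [lintegral_smul_measure, lintegral_add_measure, lintegral_dirac, lintegral_dirac, smul_eq_mul]

/-- Re-rooting `c • (δ_a + δ_b)` at `y`: `θ_y` moves the atoms to `a - y`, `b - y`. [folklore] -/
theorem map_sub_smul_dirac_add_dirac (c : ℝ≥0∞) (a b y : (EuclideanSpace ℝ (Fin 3))) :
    (c • (Measure.dirac a + Measure.dirac b)).map (fun z => z - y) =
      c • (Measure.dirac (a - y) + Measure.dirac (b - y)) := by
  rw [Measure.map_smul, Measure.map_add _ _ (measurable_sub_const y),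
    Measure.map_dirac' (measurable_sub_const y), Measure.map_dirac' (measurable_sub_const y)]

/-- `rootEnergy` is homogeneous in the configuration measure. [folklore] -/
theorem rootEnergy_smul_measure (V : ℝ → ℝ) (c : ℝ≥0∞) (μ : Measure (EuclideanSpace ℝ (Fin 3))) :
    rootEnergy V (c • μ) = c.toReal * rootEnergy V μ := by
  rw [rootEnergy, rootEnergy, integral_smul_measure, smul_eq_mul, mul_div_assoc]

/-- `rootEnergy V (δ_a + δ_b) = (V ‖a‖ + V ‖b‖)/2` for `a ≠ b`. [folklore] -/
theorem rootEnergy_dirac_add_dirac (V : ℝ → ℝ) {a b : (EuclideanSpace ℝ (Fin 3))} (h : a ≠ b) :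
    rootEnergy V (Measure.dirac a + Measure.dirac b) = (V ‖a‖ + V ‖b‖) / 2 := by
  classical
  rw [← count_restrict_pair h, ← Finset.coe_pair, rootEnergy_count_restrict_coe_finset,
    Finset.sum_pair h]

/-- **`{c • count|S}` is a measurable set of measures** for `S` countable (cut out by `μ Sᶜ = 0`
and `μ {x} = c`, `x ∈ S`); the `c = 1` case is the landed
`DiracLaws.measurableSet_singleton_count_restrict`. [folklore] -/
theorem measurableSet_singleton_smul_count_restrict {S : Set (EuclideanSpace ℝ (Fin 3))} (hS :
    S.Countable) (c : ℝ≥0∞) :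
    MeasurableSet ({c • (Measure.count : Measure (EuclideanSpace ℝ (Fin 3))).restrict S} : Set
        (Measure (EuclideanSpace ℝ (Fin 3)))) := by
  have hSm : MeasurableSet S := hS.measurableSet
  have key : ({c • (Measure.count : Measure (EuclideanSpace ℝ (Fin 3))).restrict S} : Set
      (Measure (EuclideanSpace ℝ (Fin 3)))) =
      {μ | μ Sᶜ = 0} ∩ ⋂ x ∈ S, {μ | μ {x} = c} := by
    ext μ
    simp only [Set.mem_singleton_iff, Set.mem_inter_iff, Set.mem_setOf_eq, Set.mem_iInter]
    constructor
    · rintro rfl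
      refine ⟨?_, fun x hx => ?_⟩
      · rw [Measure.smul_apply, count_restrict_compl S hSm, smul_zero]
      · rw [Measure.smul_apply, count_restrict_singleton hx, smul_eq_mul, mul_one]
    · rintro ⟨h0, h1⟩
      refine measure_eq_of_compl_null hS h0 ?_ fun x hx => ?_
      · rw [Measure.smul_apply, count_restrict_compl S hSm, smul_zero]
      · rw [h1 x hx, Measure.smul_apply, count_restrict_singleton hx, smul_eq_mul, mul_one]
  rw [key]
  exact (Measure.measurable_coe hSm.compl (measurableSet_singleton 0)).inter
    (MeasurableSet.biInter hS fun x _ =>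
      Measure.measurable_coe (measurableSet_singleton x) (measurableSet_singleton c))

/-! ## §2 The witness -/

/-- **(H_C) The hard-core clause is load-bearing — the doubled dimer.** The crux with the clause
`∀ᵐ μ ∂P, IsRootedHardCore δ μ` deleted (and the then idle binder `∀ δ > 0` dropped) is false. Put
multiplicity
`m = 2³³` on the root and on ONE neighbour at distance `1`: `ν₁ = m(δ_0 + δ_v)`, `ν₂ = m(δ_0 +
δ_{-v})`,
`‖v‖ = 1`, and root uniformly: `P = ½δ_{ν₁} + ½δ_{ν₂}`. Re-rooting swaps `ν₁ ↔ ν₂`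
(`θ_v ν₁ = ν₂`, `θ_{-v} ν₂ = ν₁`), so `P` satisfies the Mecke identity VERBATIM; it is a probability
law; its mean root energy is `m · V_LJ(1)/2 = −2³³/24 = −2³²/12 ≤ e*` (the tree's floor on `e*`,
`neg_le_eStar`) — the `m` coincident particles at the root do not repel because `V_LJ(0) = 0`
(`0⁻¹ = 0`); and the support `{0, ±v}` is bounded, so no sample is relatively dense. Hence any
proof must use that configurations are SIMPLE counting measures: the clause `IsRootedHardCore`
neutralises multiplicity and the `V(0)` junk at once (separation proper, `0 < δ`, is not what this
witness violates: its support is `1`-separated). [folklore] -/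
theorem minimisingLawsCohesive_false_without_hardCore :
    ¬ (∀ P : Measure (Measure (EuclideanSpace ℝ (Fin 3))), IsProbabilityMeasure P →
        IsPointStationaryLaw P →
        (∫ μ, rootEnergy lennardJones μ ∂P) ≤
          (⨅ Q : PeriodicConfiguration 3, Q.energyPerParticle lennardJones) →
        ∀ᵐ μ ∂P, ∃ R₀ : ℝ, ∀ z : (EuclideanSpace ℝ (Fin 3)), ∃ y : (EuclideanSpace ℝ (Fin 3)),
          μ {y} ≠ 0 ∧ dist z y ≤ R₀) := by
  intro H
  -- the doubled dimer, rooted at either end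
  set M : ℕ := 2 ^ 33 with hM
  set v : (EuclideanSpace ℝ (Fin 3)) := EuclideanSpace.single 0 1 with hv
  have hv1 : ‖v‖ = 1 := by rw [hv, PiLp.norm_single, norm_one]
  have hv0 : (0 : (EuclideanSpace ℝ (Fin 3))) ≠ v := fun h => by
    have h' := congrArg (fun w : (EuclideanSpace ℝ (Fin 3)) => ‖w‖) h
    simp only [norm_zero, hv1] at h'
    exact zero_ne_one h'
  have hv0' : (0 : (EuclideanSpace ℝ (Fin 3))) ≠ -v := fun h => by
    have h' := congrArg (fun w : (EuclideanSpace ℝ (Fin 3)) => ‖w‖) h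
    simp only [norm_zero, norm_neg, hv1] at h'
    exact zero_ne_one h'
  set ν₁ : Measure (EuclideanSpace ℝ (Fin 3)) := (M : ℝ≥0∞) • (Measure.dirac 0 + Measure.dirac v)
      with hν₁
  set ν₂ : Measure (EuclideanSpace ℝ (Fin 3)) := (M : ℝ≥0∞) • (Measure.dirac 0 + Measure.dirac
      (-v)) with hν₂
  -- measurable atoms of the Giry σ-algebra
  have hm₁ : MeasurableSet ({ν₁} : Set (Measure (EuclideanSpace ℝ (Fin 3)))) := by
    rw [hν₁, ← count_restrict_pair hv0]
    exact measurableSet_singleton_smul_count_restrict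
      ((Set.finite_singleton v).insert 0).countable _
  have hm₂ : MeasurableSet ({ν₂} : Set (Measure (EuclideanSpace ℝ (Fin 3)))) := by
    rw [hν₂, ← count_restrict_pair hv0']
    exact measurableSet_singleton_smul_count_restrict
      ((Set.finite_singleton (-v)).insert 0).countable _
  -- sums over the two atoms, and re-rooting swaps the two copies
  have hl₁ : ∀ F : (EuclideanSpace ℝ (Fin 3)) → ℝ≥0∞, ∫⁻ y, F y ∂ν₁ = M * (F 0 + F v) := fun F => by
    rw [hν₁]; exact lintegral_smul_dirac_add_dirac _ _ _ F
  have hl₂ : ∀ F : (EuclideanSpace ℝ (Fin 3)) → ℝ≥0∞, ∫⁻ y, F y ∂ν₂ = M * (F 0 + F (-v)) := fun F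
      => by
    rw [hν₂]; exact lintegral_smul_dirac_add_dirac _ _ _ F
  have hmap₁0 : ν₁.map (fun z => z - 0) = ν₁ := by simp only [sub_zero, Measure.map_id']
  have hmap₂0 : ν₂.map (fun z => z - 0) = ν₂ := by simp only [sub_zero, Measure.map_id']
  have hmap₁v : ν₁.map (fun z => z - v) = ν₂ := by
    rw [hν₁, hν₂, map_sub_smul_dirac_add_dirac, zero_sub, sub_self, add_comm (Measure.dirac (-v))]
  have hmap₂v : ν₂.map (fun z => z - -v) = ν₁ := by
    rw [hν₂, hν₁, map_sub_smul_dirac_add_dirac, zero_sub, neg_neg, sub_self,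
      add_comm (Measure.dirac v)]
  -- the uniformly rooted law
  set P : Measure (Measure (EuclideanSpace ℝ (Fin 3))) :=
    (2⁻¹ : ℝ≥0∞) • Measure.dirac ν₁ + (2⁻¹ : ℝ≥0∞) • Measure.dirac ν₂ with hP
  have hprob : IsProbabilityMeasure P := by
    refine ⟨?_⟩
    rw [hP, Measure.add_apply, Measure.smul_apply, Measure.smul_apply, measure_univ, measure_univ,
      smul_eq_mul, mul_one, ENNReal.inv_two_add_inv_two]
  have hst : IsPointStationaryLaw P := by
    intro g _
    simp only [hP, lintegral_add_measure, lintegral_smul_measure, lintegral_dirac_of_mem hm₁,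
      lintegral_dirac_of_mem hm₂, hl₁, hl₂, hmap₁0, hmap₁v, hmap₂0, hmap₂v, neg_zero, neg_neg]
    ring
  -- the mean root energy: `m · V_LJ(1) / 2` at either root
  have hE₁ : rootEnergy lennardJones ν₁ = -(2 ^ 33 : ℝ) / 24 := by
    rw [hν₁, rootEnergy_smul_measure, rootEnergy_dirac_add_dirac _ hv0, norm_zero, hv1,
      lennardJones_zero, lennardJones_one, ENNReal.toReal_natCast, hM]
    push_cast
    ring
  have hE₂ : rootEnergy lennardJones ν₂ = -(2 ^ 33 : ℝ) / 24 := by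
    rw [hν₂, rootEnergy_smul_measure, rootEnergy_dirac_add_dirac _ hv0', norm_zero, norm_neg, hv1,
      lennardJones_zero, lennardJones_one, ENNReal.toReal_natCast, hM]
    push_cast
    ring
  have hi₁ : Integrable (fun μ : Measure (EuclideanSpace ℝ (Fin 3)) => rootEnergy lennardJones μ)
      (Measure.dirac ν₁) :=
    (integrable_congr (ae_dirac_of_mem hm₁
      (p := fun μ => rootEnergy lennardJones μ = rootEnergy lennardJones ν₁) rfl)).2
      (integrable_const _)
  have hi₂ : Integrable (fun μ : Measure (EuclideanSpace ℝ (Fin 3)) => rootEnergy lennardJones μ)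
      (Measure.dirac ν₂) :=
    (integrable_congr (ae_dirac_of_mem hm₂
      (p := fun μ => rootEnergy lennardJones μ = rootEnergy lennardJones ν₂) rfl)).2
      (integrable_const _)
  have h2 : ((2 : ℝ≥0∞)⁻¹).toReal = 2⁻¹ := by simp
  have hI : ∫ μ, rootEnergy lennardJones μ ∂P = -(2 ^ 33 : ℝ) / 24 := by
    rw [hP, integral_add_measure (hi₁.smul_measure (by simp)) (hi₂.smul_measure (by simp)),
      integral_smul_measure, integral_smul_measure, integral_dirac_of_mem hm₁,
      integral_dirac_of_mem hm₂, hE₁, hE₂, h2, smul_eq_mul]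
    ring
  have hEle : (∫ μ, rootEnergy lennardJones μ ∂P) ≤
      (⨅ Q : PeriodicConfiguration 3, Q.energyPerParticle lennardJones) := by
    rw [hI]
    refine le_trans ?_ neg_le_eStar
    norm_num
  -- apply the clause-free crux and read off the atom `ν₁`
  have hconc := H P hprob hst hEle
  rw [ae_iff] at hconc
  set s : Set (Measure (EuclideanSpace ℝ (Fin 3))) := {μ | ¬ ∃ R₀ : ℝ, ∀ z : (EuclideanSpace ℝ
      (Fin 3)), ∃ y : (EuclideanSpace ℝ (Fin 3)), μ {y} ≠ 0 ∧ dist z y ≤ R₀}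
    with hs
  have hsupp : ∀ y : (EuclideanSpace ℝ (Fin 3)), ν₁ {y} ≠ 0 → ‖y‖ ≤ 1 := by
    intro y hy
    by_contra hgt
    have hy0 : (0 : (EuclideanSpace ℝ (Fin 3))) ∉ ({y} : Set (EuclideanSpace ℝ (Fin 3))) := fun h
        => by
      rw [mem_singleton_iff] at h
      apply hgt
      rw [← h, norm_zero]
      exact zero_le_one
    have hyv : v ∉ ({y} : Set (EuclideanSpace ℝ (Fin 3))) := fun h => by
      rw [mem_singleton_iff] at h
      apply hgt
      rw [← h, hv1]
    apply hy
    rw [hν₁, Measure.smul_apply, Measure.add_apply,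
      Measure.dirac_apply' _ (measurableSet_singleton y),
      Measure.dirac_apply' _ (measurableSet_singleton y), indicator_of_notMem hy0,
      indicator_of_notMem hyv, add_zero, smul_zero]
  have hmem : ν₁ ∈ s := by
    rintro ⟨R₀, hR⟩
    obtain ⟨y, hy, hzy⟩ := hR (EuclideanSpace.single 0 (|R₀| + 2))
    have h1 : ‖(EuclideanSpace.single 0 (|R₀| + 2) : (EuclideanSpace ℝ (Fin 3)))‖ = |R₀| + 2 := by
      rw [PiLp.norm_single, Real.norm_eq_abs, abs_of_pos (by positivity)]
    have h3 := norm_sub_norm_le (EuclideanSpace.single 0 (|R₀| + 2) : (EuclideanSpace ℝ (Fin 3))) y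
    rw [← dist_eq_norm, h1] at h3
    linarith [hsupp y hy, le_abs_self R₀]
  have h1 : (1 : ℝ≥0∞) ≤ Measure.dirac ν₁ s := by
    refine le_trans (le_of_eq ?_) Measure.le_dirac_apply
    rw [indicator_of_mem hmem, Pi.one_apply]
  have h3 : (2⁻¹ : ℝ≥0∞) ≤ P s := by
    rw [hP, Measure.add_apply, Measure.smul_apply, Measure.smul_apply, smul_eq_mul, smul_eq_mul]
    calc (2⁻¹ : ℝ≥0∞) = 2⁻¹ * 1 := (mul_one _).symm
      _ ≤ 2⁻¹ * Measure.dirac ν₁ s := by gcongr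
      _ ≤ _ := le_self_add
  rw [hconc] at h3
  have h4 : (2⁻¹ : ℝ≥0∞) ≠ 0 := by simp
  exact h4 (nonpos_iff_eq_zero.1 h3)

end Summit.AtomisticToContinuum.Crystallization.Theorems.MinimisingLawsCohesive.Negative

end
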